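import Summits.Parity.GeneralizedHardyLittlewood.Theses.FordMaynardSieveConst01651

/-!
# Route `FordMaynardSieveConst01651` — assembly item `Assembly` (stmt-Parity-19188)

`Assembly := GCert01651 → FMThm73aLevelHalf → SieveConst01651`: the certified `(𝟙⋆g)`-certificate `GCert01651`
plus the named fact Ford–Maynard Theorem 7.3 (a) at level `1/2`
(`Literature.NumberTheory.Sieve.FordMaynard.FordMaynard2024_thm73a_levelHalf.exists_pos`, p406831) give a positive
linear-sieve constant at `ν = 0.1651` (`0 < ν < 1/4` by `norm_num`), and monotonicity
`IsLowerSieveConst.mono` (Ford–Maynard Prop. 4.10) carries it to every `ν' ∈ [0.1651, 1/3)`; the `ν' < 1/3`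
hypothesis of the threshold shape is not used.  Candidate term of record: planner p3 evidence
`AssemblyB_holds.lean` (pub/parity-ideate/parity-ideate-p3/evidence2/, sha16 66d8dbff2069191f), refuter re-check
2026-08-27 (`Cand.lean` 9a3a83e8e0575fb5) and writer g19 farm re-check 2026-08-31 rc 0; landed verbatim by the
decomp-parity landing hand leafhand-parity-fmcert-1 g0.  Rung F-P1 bookkeeping, no summit motion.
Standard axioms only.
-/

namespace Summit.Parity.GeneralizedHardyLittlewood.Theses.FordMaynardSieveConst01651

/-- **`Assembly` holds** (route `FordMaynardSieveConst01651`, stmt-Parity-19188):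
`GCert01651 → FMThm73aLevelHalf → SieveConst01651` — Ford–Maynard Thm 7.3 (a) (`FordMaynard2024_thm73a_levelHalf.exists_pos`)
on the `GCert01651` witness `g` gives `c > 0` with `IsLowerSieveConst (1/2) 0 0.1651 c`, then `IsLowerSieveConst.mono`
to every `ν ≥ 0.1651`. -/
theorem assembly_holds : Summit.Parity.GeneralizedHardyLittlewood.Theses.FordMaynardSieveConst01651.Assembly := by
  intro h1 h2 ν hν _hν3
  obtain ⟨g, hs, hpc, h0, hsupp, hH, hV⟩ := h1
  obtain ⟨c, hc, hconst⟩ :=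
    Literature.NumberTheory.Sieve.FordMaynard.FordMaynard2024_thm73a_levelHalf.exists_pos h2
      (by norm_num) (by norm_num) hs hpc h0 hsupp hH hV
  exact ⟨c, hc, hconst.mono hν⟩

end Summit.Parity.GeneralizedHardyLittlewood.Theses.FordMaynardSieveConst01651
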